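import Mathlib.Analysis.Matrix.Spectrum
import Mathlib.Analysis.Matrix.PosDef
import Mathlib.Analysis.MeanInequalities
import Mathlib.Analysis.SpecialFunctions.Pow.Real
import Mathlib.LinearAlgebra.Matrix.Determinant.Basic
import HarnessLib

/-!
# Hadamard's inequality for complex matrices

`‖det A‖² ≤ ∏ᵢ ∑ⱼ ‖Aᵢⱼ‖²` for a square complex matrix `A` (J. Hadamard, *Résolution d'une question
relative aux déterminants*, Bull. Sci. Math. 17 (1893), 240–246), in the form used for Vandermonde
and discriminant estimates (e.g. Bugeaud, *Approximation by Algebraic Numbers*, proofs of Thm. A.3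
and Lemma A.8). Proof: after dividing each non-zero row by its `ℓ²` norm, `H = B Bᴴ` is positive
semidefinite with `trace H = card n` and `det H = ‖det B‖²`; AM–GM on the (real, non-negative)
eigenvalues of `H` gives `det H ≤ (trace H / card n) ^ card n = 1`.

## Contents
* `prod_le_arith_mean_pow` — AM–GM in product form `∏ zᵢ ≤ (∑ zᵢ / m)ᵐ`.
* `det_re_le_of_posSemidef` — `det H ≤ (tr H / m)ᵐ` for `H` positive semidefinite.
* `norm_det_sq_le_prod_sum_sq` — Hadamard's inequality; `norm_det_le_of_entry_le` — the row-wise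
  bounded-entry corollary `‖det A‖ ≤ ∏ᵢ (√m · cᵢ)` when `‖Aᵢⱼ‖ ≤ cᵢ`.
-/

namespace Literature.Analysis.Matrix

open Finset
open scoped ComplexConjugate ComplexOrder

variable {n : Type*} [Fintype n] [DecidableEq n]

omit [DecidableEq n] in
/-- AM–GM in product form: for non-negative reals `zᵢ` indexed by a non-empty finite type of
cardinality `m`, `∏ zᵢ ≤ (∑ zᵢ / m) ^ m`. [folklore] -/
theorem prod_le_arith_mean_pow (z : n → ℝ) (hz : ∀ i, 0 ≤ z i) (hn : 0 < Fintype.card n) :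
    ∏ i, z i ≤ ((∑ i, z i) / Fintype.card n) ^ Fintype.card n := by
  set m : ℕ := Fintype.card n with hm
  have hm0 : (m : ℝ) ≠ 0 := by exact_mod_cast hn.ne'
  have hw : ∀ i ∈ (univ : Finset n), 0 ≤ (fun _ : n => (m : ℝ)⁻¹) i := fun _ _ => by positivity
  have hw' : ∑ i ∈ (univ : Finset n), (fun _ : n => (m : ℝ)⁻¹) i = 1 := by
    rw [Finset.sum_const, Finset.card_univ, ← hm, nsmul_eq_mul, mul_inv_cancel₀ hm0]
  have h := Real.geom_mean_le_arith_mean_weighted (univ : Finset n) (fun _ => (m : ℝ)⁻¹) z hw hw'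
    (fun i _ => hz i)
  -- `h : ∏ zᵢ ^ (1/m) ≤ ∑ (1/m) zᵢ`
  have hprod : ∏ i, z i ^ ((m : ℝ)⁻¹) = (∏ i, z i) ^ ((m : ℝ)⁻¹) :=
    Real.finsetProd_rpow _ _ (fun i _ => hz i) _
  rw [hprod, ← Finset.mul_sum] at h
  have h0 : 0 ≤ ∏ i, z i := Finset.prod_nonneg fun i _ => hz i
  calc ∏ i, z i = ((∏ i, z i) ^ ((m : ℝ)⁻¹)) ^ m := (Real.rpow_inv_natCast_pow h0 hn.ne').symm
    _ ≤ ((m : ℝ)⁻¹ * ∑ i, z i) ^ m := by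
        gcongr
    _ = ((∑ i, z i) / m) ^ m := by rw [inv_mul_eq_div]

/-- For a positive semidefinite complex matrix `H` of size `m ≥ 1`, `det H ≤ (trace H / m) ^ m`
(both sides are real; AM–GM on the eigenvalues). [folklore] -/
theorem det_re_le_of_posSemidef {H : Matrix n n ℂ} (hH : H.PosSemidef) (hn : 0 < Fintype.card n) :
    (H.det).re ≤ ((H.trace).re / Fintype.card n) ^ Fintype.card n := by
  have hdet : H.det = ((∏ i, hH.1.eigenvalues i : ℝ) : ℂ) := by
    rw [hH.1.det_eq_prod_eigenvalues]; push_cast; rfl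
  have htr : H.trace = ((∑ i, hH.1.eigenvalues i : ℝ) : ℂ) := by
    rw [hH.1.trace_eq_sum_eigenvalues]; push_cast; rfl
  rw [hdet, htr, Complex.ofReal_re, Complex.ofReal_re]
  exact prod_le_arith_mean_pow _ (fun i => hH.eigenvalues_nonneg i) hn

/-- `det (B Bᴴ) = ‖det B‖²`. [folklore] -/
theorem det_mul_conjTranspose_self (B : Matrix n n ℂ) :
    (B * B.conjTranspose).det = ((‖B.det‖ ^ 2 : ℝ) : ℂ) := by
  rw [Matrix.det_mul, Matrix.det_conjTranspose, Complex.star_def, Complex.mul_conj,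
    Complex.normSq_eq_norm_sq]

omit [DecidableEq n] in
/-- `trace (B Bᴴ) = ∑ᵢⱼ ‖Bᵢⱼ‖²`. [folklore] -/
theorem trace_mul_conjTranspose_self (B : Matrix n n ℂ) :
    (B * B.conjTranspose).trace = ((∑ i, ∑ j, ‖B i j‖ ^ 2 : ℝ) : ℂ) := by
  simp only [Matrix.trace, Matrix.diag, Matrix.mul_apply, Matrix.conjTranspose_apply,
    Complex.star_def, Complex.mul_conj, Complex.normSq_eq_norm_sq]
  push_cast
  rfl

/-- **Hadamard's inequality** (complex matrices): `‖det A‖² ≤ ∏ᵢ ∑ⱼ ‖Aᵢⱼ‖²`.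
[cite: Bugeaud2004, proof of Thm A.3] -/
theorem norm_det_sq_le_prod_sum_sq (A : Matrix n n ℂ) :
    ‖A.det‖ ^ 2 ≤ ∏ i, ∑ j, ‖A i j‖ ^ 2 := by
  classical
  -- a zero row makes both sides trivial
  by_cases hrow : ∃ i, ∀ j, A i j = 0
  · obtain ⟨i, hi⟩ := hrow
    rw [Matrix.det_eq_zero_of_row_eq_zero i hi, norm_zero, zero_pow two_ne_zero]
    exact Finset.prod_nonneg fun i _ => Finset.sum_nonneg fun j _ => by positivity
  push Not at hrow
  -- empty index type: both sides are `1`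
  rcases Nat.eq_zero_or_pos (Fintype.card n) with hcard | hcard
  · haveI : IsEmpty n := Fintype.card_eq_zero_iff.1 hcard
    simp [Matrix.det_isEmpty]
  set r : n → ℝ := fun i => ∑ j, ‖A i j‖ ^ 2 with hr
  have hrpos : ∀ i, 0 < r i := by
    intro i
    obtain ⟨j, hj⟩ := hrow i
    exact lt_of_lt_of_le (by positivity : 0 < ‖A i j‖ ^ 2)
      (Finset.single_le_sum (f := fun j => ‖A i j‖ ^ 2) (fun j _ => by positivity) (mem_univ j))
  set s : n → ℝ := fun i => Real.sqrt (r i) with hs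
  have hspos : ∀ i, 0 < s i := fun i => Real.sqrt_pos.2 (hrpos i)
  have hs2 : ∀ i, s i ^ 2 = r i := fun i => Real.sq_sqrt (hrpos i).le
  set B : Matrix n n ℂ := Matrix.of fun i j => A i j / (s i : ℂ) with hB
  have hAB : A = Matrix.diagonal (fun i => (s i : ℂ)) * B := by
    ext i j
    rw [Matrix.diagonal_mul, hB, Matrix.of_apply, mul_div_cancel₀]
    exact_mod_cast (hspos i).ne'
  have hdetA : ‖A.det‖ ^ 2 = (∏ i, r i) * ‖B.det‖ ^ 2 := by
    rw [hAB, Matrix.det_mul, Matrix.det_diagonal, norm_mul, mul_pow, norm_prod, ← Finset.prod_pow]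
    congr 1
    exact Finset.prod_congr rfl fun i _ => by
      rw [Complex.norm_real, Real.norm_of_nonneg (hspos i).le, hs2]
  -- rows of `B` have unit `ℓ²` norm
  have hBrow : ∀ i, ∑ j, ‖B i j‖ ^ 2 = 1 := by
    intro i
    have : ∑ j, ‖B i j‖ ^ 2 = (∑ j, ‖A i j‖ ^ 2) / s i ^ 2 := by
      rw [Finset.sum_div]
      refine Finset.sum_congr rfl fun j _ => ?_
      rw [hB, Matrix.of_apply, norm_div, div_pow, Complex.norm_real, Real.norm_of_nonneg (hspos i).le]
    rw [this, hs2]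
    exact div_self (hrpos i).ne'
  -- AM–GM on `H = B Bᴴ`
  have hH : (B * B.conjTranspose).PosSemidef := Matrix.posSemidef_self_mul_conjTranspose B
  have hle := det_re_le_of_posSemidef hH hcard
  rw [det_mul_conjTranspose_self, trace_mul_conjTranspose_self, Complex.ofReal_re,
    Complex.ofReal_re] at hle
  simp only [hBrow, Finset.sum_const, Finset.card_univ, nsmul_eq_mul, mul_one] at hle
  rw [div_self (by exact_mod_cast hcard.ne'), one_pow] at hle
  calc ‖A.det‖ ^ 2 = (∏ i, r i) * ‖B.det‖ ^ 2 := hdetA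
    _ ≤ (∏ i, r i) * 1 := by gcongr
    _ = ∏ i, ∑ j, ‖A i j‖ ^ 2 := by rw [mul_one]

/-- Row-wise corollary of Hadamard's inequality: if `‖Aᵢⱼ‖ ≤ cᵢ` for all `j`
then `‖det A‖ ^ 2 ≤ ∏ᵢ (m · cᵢ²)`, `m` the size. [cite: Bugeaud2004, proof of Lemma A.8] -/
theorem norm_det_sq_le_of_entry_le (A : Matrix n n ℂ) (c : n → ℝ)
    (h : ∀ i j, ‖A i j‖ ≤ c i) :
    ‖A.det‖ ^ 2 ≤ ∏ i, ((Fintype.card n : ℝ) * c i ^ 2) := by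
  refine (norm_det_sq_le_prod_sum_sq A).trans (Finset.prod_le_prod
    (fun i _ => Finset.sum_nonneg fun j _ => by positivity) fun i _ => ?_)
  calc ∑ j, ‖A i j‖ ^ 2 ≤ ∑ _j : n, c i ^ 2 :=
        Finset.sum_le_sum fun j _ => pow_le_pow_left₀ (norm_nonneg _) (h i j) 2
    _ = (Fintype.card n : ℝ) * c i ^ 2 := by simp

end Literature.Analysis.Matrix
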